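import Literature.Barriers.AtomisticToContinuum.DisorderedHarmonicChainVariations
import Literature.Analysis.Calculus.SmoothCutoff
import HarnessLib

/-!
# Ajanki–Huveneers 2011: the regularised test functional of the integration by parts and its first variation

Definitions file of the integration-by-parts route to the upper bound (5.1) of Prop. 5.1 of
O. Ajanki, F. Huveneers, CMP **301** (2011) 841–883, arXiv:1003.1076
("`𝔼(e^{w∑h(X_{k-1})B_k} u(X_n)) ≤ K/(w√n) ∫_𝕋 u`", proved in the paper by a parametrix; here we
integrate by parts on the disorder along the smoothing field `V = ∑_k a_k ξ(B_k) ∂_k` of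
`…Variations.lean`, which avoids the refuted Lemma 5.3). On the lifted chain `X_j = ahPhase w x B j`
with tilt exponent `T_n = w ∑_{j<n} h(X_j) B_j` (the weight `e^{T_n}` of Prop. 5.1) we define

* `duT`, `duDT`: the tilt exponent and its section derivative `∂_k T_n`;
* `duU = J_n N_n` (`= V X_n`, `sum_vaW_mul_vaDX`) and `duDU = ∂_k U`;
* `duChi L`, `duDChi L`: the smooth cutoff `χ_L(s) = smoothTransition(s/L - 1)` (`0` below `L`,
  `1` above `2L`) and its derivative;
* `duPsi`: the regularised functional `Ψ_ε = G(X_n) e^{T_n} χ_L(N_{m₁}) / (U + ε)` fed to the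
  integration by parts, and `duD k = ∂_k Ψ_ε` (`G` a primitive of the test function `g`);

and PROVE the calculus behind the integration by parts: the section derivatives
(`hasDerivAt_duT_update`, `hasDerivAt_duU_update`, `hasDerivAt_duChi`, `hasDerivAt_duPsi_update`)
and the first-variation identities along `V` (`sum_vaW_mul_duDT`, `sum_vaW_mul_duDU`,
`sum_vaW_mul_duD`: `V Ψ_ε = g(X_n) e^{T} χ U/(U+ε) + G(X_n)·{(VT) e^T χ/(U+ε) + e^T χ'(VN_{m₁})/(U+ε)
- e^T χ (VU)/(U+ε)²}`).

[cite: AjankiHuveneers2011, Prop. 5.1 eq. (5.1); Lemma 3.2 eq. (3.10)] (the weight `e^{w∑h(X)B}` and the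
step `f_b`); the integration by parts along the disorder itself is [folklore] (Malliavin-type).
-/

noncomputable section

open Real Finset Function

namespace Literature.Barriers.AtomisticToContinuum.HeatConduction

/-! ### The objects -/

section Defs

variable (w x : ℝ) (h : ℝ → ℝ) (B : ℕ → ℝ)

/-- The tilt exponent `T_n = w ∑_{j<n} h(X_j) B_j` of the weight `e^{w∑_{k=1}^n h(X_{k-1})B_k}` of
Prop. 5.1. [cite: AjankiHuveneers2011, Prop. 5.1 eq. (5.1)] -/
def duT (n : ℕ) : ℝ := w * ∑ j ∈ Finset.range n, h (ahPhase w x B j) * B j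

/-- `∂T_n/∂B_k = w ∑_{j<n} (h'(X_j) (∂X_j/∂B_k) B_j + [j = k] h(X_j))`. [folklore] -/
def duDT (n k : ℕ) : ℝ :=
  w * ∑ j ∈ Finset.range n,
    (deriv h (ahPhase w x B j) * vaDX w x B k j * B j + if j = k then h (ahPhase w x B j) else 0)

/-- `U_n = J_n N_n` (`= V X_n`, the first variation of the phase along the smoothing field).
[folklore] -/
def duU (ξ : ℝ → ℝ) (n : ℕ) : ℝ := vaJ w x B n * vaN w x B ξ n

/-- `∂U_n/∂B_k = (∂_k J_n) N_n + J_n (∂_k N_n)`. [folklore] -/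
def duDU (ξ : ℝ → ℝ) (n k : ℕ) : ℝ :=
  vaDJ w x B k n * vaN w x B ξ n + vaJ w x B n * vaDN w x B ξ k n

end Defs

/-- The smooth cutoff `χ_L(s) = smoothTransition(s/L - 1)`: `0` for `s ≤ L`, `1` for `s ≥ 2L`.
[folklore] -/
def duChi (L s : ℝ) : ℝ := Real.smoothTransition (s / L - 1)

/-- `χ_L'(s) = smoothTransition'(s/L - 1)/L`. [folklore] -/
def duDChi (L s : ℝ) : ℝ := deriv Real.smoothTransition (s / L - 1) / L

section Defs2

variable (w x : ℝ) (h ξ G : ℝ → ℝ) (n m₁ : ℕ) (L ε : ℝ) (B : ℕ → ℝ)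

/-- **The regularised test functional** `Ψ_ε = G(X_n) e^{T_n} χ_L(N_{m₁}) (U_n + ε)⁻¹`. [folklore] -/
def duPsi : ℝ :=
  G (ahPhase w x B n) * Real.exp (duT w x h B n) * duChi L (vaN w x B ξ m₁) * (duU w x B ξ n + ε)⁻¹

/-- **`∂_k Ψ_ε`** (`g = G'`):
`g(X_n)(∂_kX_n) e^T χ R + G(X_n)·{e^T (∂_kT) χ R + e^T χ'(N_{m₁})(∂_k N_{m₁}) R - e^T χ (∂_kU) R²}`,
`R = (U + ε)⁻¹`. [folklore] -/
def duD (g : ℝ → ℝ) (k : ℕ) : ℝ :=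
  g (ahPhase w x B n) * vaDX w x B k n * Real.exp (duT w x h B n) * duChi L (vaN w x B ξ m₁) *
      (duU w x B ξ n + ε)⁻¹ +
    G (ahPhase w x B n) *
      (Real.exp (duT w x h B n) * duDT w x h B n k * duChi L (vaN w x B ξ m₁) * (duU w x B ξ n + ε)⁻¹ +
        Real.exp (duT w x h B n) * (duDChi L (vaN w x B ξ m₁) * vaDN w x B ξ k m₁) *
          (duU w x B ξ n + ε)⁻¹ +
        Real.exp (duT w x h B n) * duChi L (vaN w x B ξ m₁) *
          (-(duDU w x B ξ n k) / (duU w x B ξ n + ε) ^ 2))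

end Defs2

/-! ### The cutoff -/

section Chi

/-- `χ_L = 0` below `L` (`L > 0`). [folklore] -/
theorem duChi_eq_zero {L s : ℝ} (hL : 0 < L) (hs : s ≤ L) : duChi L s = 0 := by
  unfold duChi
  refine Real.smoothTransition.zero_of_nonpos ?_
  rw [sub_nonpos, div_le_one hL]; exact hs

/-- `χ_L = 1` above `2L` (`L > 0`). [folklore] -/
theorem duChi_eq_one {L s : ℝ} (hL : 0 < L) (hs : 2 * L ≤ s) : duChi L s = 1 := by
  unfold duChi
  refine Real.smoothTransition.one_of_one_le ?_
  rw [le_sub_iff_add_le, le_div_iff₀ hL]; linarith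

/-- `0 ≤ χ_L ≤ 1`. [folklore] -/
theorem duChi_mem (L s : ℝ) : 0 ≤ duChi L s ∧ duChi L s ≤ 1 :=
  ⟨Real.smoothTransition.nonneg _, Real.smoothTransition.le_one _⟩

/-- `χ_L > 0` forces `s > L` (`L > 0`). [folklore] -/
theorem lt_of_duChi_pos {L s : ℝ} (hL : 0 < L) (h : 0 < duChi L s) : L < s := by
  by_contra hs
  push Not at hs
  rw [duChi_eq_zero hL hs] at h
  exact lt_irrefl _ h

/-- `χ_L` is differentiable with derivative `χ_L'` (for `L = 0` both sides degenerate consistently,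
with Lean's `x/0 = 0`). [folklore] -/
theorem hasDerivAt_duChi (L s : ℝ) : HasDerivAt (duChi L) (duDChi L s) s := by
  unfold duChi duDChi
  have hd : Differentiable ℝ Real.smoothTransition :=
    Real.smoothTransition.contDiff.differentiable one_ne_zero
  have hin : HasDerivAt (fun s : ℝ => s / L - 1) (1 / L) s := by
    simpa using ((hasDerivAt_id s).div_const L).sub_const 1
  have h2 := (hd (s / L - 1)).hasDerivAt.comp s hin
  exact h2.congr_deriv (by ring)

/-- `χ_L` is continuous. [folklore] -/
theorem continuous_duChi (L : ℝ) : Continuous (duChi L) := by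
  unfold duChi
  exact Real.smoothTransition.continuous.comp ((continuous_id.div_const L).sub continuous_const)

/-- `χ_L'` is continuous. [folklore] -/
theorem continuous_duDChi (L : ℝ) : Continuous (duDChi L) := by
  unfold duDChi
  have hc : Continuous (deriv Real.smoothTransition) :=
    Real.smoothTransition.contDiff.continuous_deriv le_rfl
  exact (hc.comp ((continuous_id.div_const L).sub continuous_const)).div_const L

/-- **Bounds on `χ_L'`** (`L > 0`): `|χ_L'| ≤ C_χ/L`, and `χ_L'(s) ≠ 0` only for `L < s < 2L`.
[folklore] -/
theorem duDChi_bounds {L : ℝ} (hL : 0 < L) :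
    ∃ C : ℝ, 0 ≤ C ∧ (∀ s, |duDChi L s| ≤ C / L) ∧ ∀ s, duDChi L s ≠ 0 → L < s ∧ s < 2 * L := by
  obtain ⟨C, hC0, hC⟩ := Literature.Analysis.Calculus.exists_bound_deriv_smoothTransition
  refine ⟨C, hC0, fun s => ?_, fun s hs => ?_⟩
  · unfold duDChi
    rw [abs_div, abs_of_pos hL]
    exact div_le_div_of_nonneg_right (hC _) hL.le
  · unfold duDChi at hs
    have hne : deriv Real.smoothTransition (s / L - 1) ≠ 0 := fun h => hs (by rw [h, zero_div])
    constructor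
    · by_contra h1
      have : s / L - 1 ≤ 0 := by
        rw [sub_nonpos, div_le_one hL]; exact not_lt.mp h1
      exact hne (Literature.Analysis.Calculus.deriv_smoothTransition_of_nonpos this)
    · by_contra h2
      have : 1 ≤ s / L - 1 := by
        rw [le_sub_iff_add_le, le_div_iff₀ hL]; linarith [not_lt.mp h2]
      exact hne (Literature.Analysis.Calculus.deriv_smoothTransition_of_one_le this)

end Chi

/-! ### Section derivatives -/

section Derivatives

variable {w x M : ℝ} {h ξ G g : ℝ → ℝ}

/-- `∂_k T_n` is the derivative of the section `t ↦ T_n(B[k ↦ t])` at `t = B_k`, for `h ∈ C¹`,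
in the small regime. [folklore] -/
theorem hasDerivAt_duT_update (hM : 0 ≤ M) (hw0 : 0 < w) (hw : w ≤ pcW M) (B : ℕ → ℝ)
    (hB : ∀ i, |B i| ≤ M) (hh : Differentiable ℝ h) (n k : ℕ) :
    HasDerivAt (fun t => duT w x h (update B k t) n) (duDT w x h B n k) (B k) := by
  unfold duT duDT
  refine HasDerivAt.const_mul w (HasDerivAt.fun_sum fun j _ => ?_)
  have hX := hasDerivAt_ahPhase_update (x := x) hM hw0 hw B hB k j
  have hhX : HasDerivAt (fun t => h (ahPhase w x (update B k t) j))
      (deriv h (ahPhase w x B j) * vaDX w x B k j) (B k) := by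
    have := (hh (ahPhase w x (update B k (B k)) j)).hasDerivAt.comp (B k) hX
    rw [update_eq_self] at this
    exact this
  rcases eq_or_ne j k with rfl | hjk
  · have hcoord : HasDerivAt (fun t => update B j t j) 1 (B j) := by
      simp only [update_self]; exact hasDerivAt_id _
    have hprod := hhX.mul hcoord
    refine hprod.congr_deriv ?_
    simp only [update_self, update_eq_self, ↓reduceIte, mul_one]
  · have hfun : (fun t => h (ahPhase w x (update B k t) j) * update B k t j) =
        fun t => h (ahPhase w x (update B k t) j) * B j := by
      funext t; rw [update_of_ne hjk]
    rw [hfun]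
    refine (hhX.mul_const (B j)).congr_deriv ?_
    simp only [hjk, ↓reduceIte, add_zero]

/-- `∂_k U_n` is the derivative of the section of `U_n`, for `ξ ∈ C¹`. [folklore] -/
theorem hasDerivAt_duU_update (hM : 0 ≤ M) (hw0 : 0 < w) (hw : w ≤ pcW M) (B : ℕ → ℝ)
    (hB : ∀ i, |B i| ≤ M) (hξ : Differentiable ℝ ξ) (n k : ℕ) :
    HasDerivAt (fun t => duU w x (update B k t) ξ n) (duDU w x B ξ n k) (B k) := by
  unfold duU duDU
  have hJ := hasDerivAt_vaJ_update (x := x) hM hw0 hw B hB k n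
  have hN := hasDerivAt_vaN_update (x := x) hM hw0 hw B hB hξ k n
  refine (hJ.mul hN).congr_deriv ?_
  simp only [update_eq_self]

/-- `U_n ≥ 0` for a non-negative bump. [folklore] -/
theorem duU_nonneg (w x : ℝ) (B : ℕ → ℝ) {ξ : ℝ → ℝ} (hξ0 : ∀ b, 0 ≤ ξ b) (n : ℕ) :
    0 ≤ duU w x B ξ n := by
  unfold duU vaN
  refine mul_nonneg (vaJ_pos w x B n).le (Finset.sum_nonneg fun k _ => ?_)
  exact mul_nonneg (hξ0 _) (vaU_bounds w x B k).1

/-- **`∂_k Ψ_ε` is the derivative of the section of `Ψ_ε`** (`G' = g`, `h, ξ ∈ C¹`, `ξ ≥ 0`,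
`ε > 0`), in the small regime. [folklore] -/
theorem hasDerivAt_duPsi_update (hM : 0 ≤ M) (hw0 : 0 < w) (hw : w ≤ pcW M) (B : ℕ → ℝ)
    (hB : ∀ i, |B i| ≤ M) (hh : Differentiable ℝ h) (hξ : Differentiable ℝ ξ)
    (hξ0 : ∀ b, 0 ≤ ξ b) (hG : ∀ y, HasDerivAt G (g y) y) (L : ℝ) {ε : ℝ} (hε : 0 < ε)
    (n m₁ k : ℕ) :
    HasDerivAt (fun t => duPsi w x h ξ G n m₁ L ε (update B k t)) (duD w x h ξ G n m₁ L ε B g k)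
      (B k) := by
  have hX := hasDerivAt_ahPhase_update (x := x) hM hw0 hw B hB k n
  have h1 : HasDerivAt (fun t => G (ahPhase w x (update B k t) n))
      (g (ahPhase w x B n) * vaDX w x B k n) (B k) := by
    have := (hG (ahPhase w x (update B k (B k)) n)).comp (B k) hX
    rw [update_eq_self] at this
    exact this
  have h2 : HasDerivAt (fun t => Real.exp (duT w x h (update B k t) n))
      (Real.exp (duT w x h B n) * duDT w x h B n k) (B k) := by
    have := (hasDerivAt_duT_update (x := x) hM hw0 hw B hB hh n k).exp
    rw [update_eq_self] at this
    exact this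
  have h3 : HasDerivAt (fun t => duChi L (vaN w x (update B k t) ξ m₁))
      (duDChi L (vaN w x B ξ m₁) * vaDN w x B ξ k m₁) (B k) := by
    have hN := hasDerivAt_vaN_update (x := x) hM hw0 hw B hB hξ k m₁
    have := (hasDerivAt_duChi L (vaN w x (update B k (B k)) ξ m₁)).comp (B k) hN
    rw [update_eq_self] at this
    exact this
  have h4 : HasDerivAt (fun t => (duU w x (update B k t) ξ n + ε)⁻¹)
      (-(duDU w x B ξ n k) / (duU w x B ξ n + ε) ^ 2) (B k) := by
    have hU := (hasDerivAt_duU_update (x := x) hM hw0 hw B hB hξ n k).add_const ε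
    have hne : duU w x (update B k (B k)) ξ n + ε ≠ 0 := by
      rw [update_eq_self]
      exact (lt_of_lt_of_le hε (le_add_of_nonneg_left (duU_nonneg w x B hξ0 n))).ne'
    have := hU.inv hne
    rw [update_eq_self] at this
    exact this
  have h := (h1.mul h2).mul h3 |>.mul h4
  unfold duPsi duD
  refine h.congr_deriv ?_
  simp only [Pi.mul_apply, update_eq_self]
  ring

/-- The same at an arbitrary value `t` (`|t| ≤ M`) of the varied coordinate. [folklore] -/
theorem hasDerivAt_duPsi_update' (hM : 0 ≤ M) (hw0 : 0 < w) (hw : w ≤ pcW M) (B : ℕ → ℝ)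
    (hB : ∀ i, |B i| ≤ M) (hh : Differentiable ℝ h) (hξ : Differentiable ℝ ξ)
    (hξ0 : ∀ b, 0 ≤ ξ b) (hG : ∀ y, HasDerivAt G (g y) y) (L : ℝ) {ε : ℝ} (hε : 0 < ε)
    (n m₁ k : ℕ) {t : ℝ} (ht : |t| ≤ M) :
    HasDerivAt (fun s => duPsi w x h ξ G n m₁ L ε (update B k s))
      (duD w x h ξ G n m₁ L ε (update B k t) g k) t := by
  have hB' : ∀ i, |update B k t i| ≤ M := fun i => by
    rcases eq_or_ne i k with rfl | hne
    · rwa [update_self]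
    · rw [update_of_ne hne]; exact hB i
  have := hasDerivAt_duPsi_update (x := x) hM hw0 hw (update B k t) hB' hh hξ hξ0 hG L hε n m₁ k
  simp only [update_idem, update_self] at this
  exact this

end Derivatives

/-! ### First-variation identities along the smoothing field -/

section Variation

variable {w x : ℝ} (h : ℝ → ℝ) (B : ℕ → ℝ)

/-- **`V T_n`**: `∑_{k<m} a_kξ(B_k) ∂_kT_n = w (∑_{j<n} h'(X_j) B_j J_j N_j + ∑_{k<n} a_kξ(B_k) h(X_k))`
for `n ≤ m`. [folklore] -/
theorem sum_vaW_mul_duDT (hw0 : 0 < w) (hw : π * w / 2 < 1) (ξ : ℝ → ℝ) {m n : ℕ} (hnm : n ≤ m) :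
    ∑ k ∈ Finset.range m, vaW w x B ξ k * duDT w x h B n k =
      w * (∑ j ∈ Finset.range n, deriv h (ahPhase w x B j) * B j * (vaJ w x B j * vaN w x B ξ j) +
        ∑ k ∈ Finset.range n, vaW w x B ξ k * h (ahPhase w x B k)) := by
  -- pull out `w` and split the summand
  have hk : ∀ k, vaW w x B ξ k * duDT w x h B n k =
      w * (∑ j ∈ Finset.range n, deriv h (ahPhase w x B j) * B j * (vaW w x B ξ k * vaDX w x B k j)) +
        w * (vaW w x B ξ k * if k ∈ Finset.range n then h (ahPhase w x B k) else 0) := by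
    intro k
    unfold duDT
    rw [Finset.sum_add_distrib, Finset.sum_ite_eq' (Finset.range n) k, mul_add, mul_add,
      Finset.mul_sum, Finset.mul_sum, Finset.mul_sum]
    congr 1
    · exact Finset.sum_congr rfl fun j _ => by ring
    · ring
  rw [Finset.sum_congr rfl fun k _ => hk k, Finset.sum_add_distrib, ← Finset.mul_sum, ← Finset.mul_sum,
    ← mul_add]
  congr 1
  congr 1
  · rw [Finset.sum_comm]
    refine Finset.sum_congr rfl fun j hj => ?_
    have hj' : j < n := Finset.mem_range.mp hj
    rw [← Finset.mul_sum, sum_vaW_mul_vaDX B hw0 hw ξ (show j ≤ m by omega)]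
  · have h1 : ∀ k, (vaW w x B ξ k * if k ∈ Finset.range n then h (ahPhase w x B k) else 0) =
        if k ∈ Finset.range n then vaW w x B ξ k * h (ahPhase w x B k) else 0 := fun k => by
      split_ifs <;> ring
    simp only [h1]
    rw [← Finset.sum_filter, Finset.filter_mem_eq_inter,
      Finset.inter_eq_right.mpr (Finset.range_subset_range.mpr hnm)]

/-- **`V U_m`** (`m` = the number of coordinates): `∑_{k<m} a_kξ(B_k) ∂_kU_m =
J_m {-(∑_{i<m} [P_x,i J_iN_i + P_δ,i πJ_iξ(B_i)]/P_i) N_m + V N_m}` with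
`V N_m = ∑_{k<m} a_kξ(B_k)ξ'(B_k)u_k + ∑_{i<m} ξ(B_i) 2π sin(2πX_i) J_iN_i`. [folklore] -/
theorem sum_vaW_mul_duDU (hw0 : 0 < w) (hw : π * w / 2 < 1) (ξ : ℝ → ℝ) (m : ℕ) :
    ∑ k ∈ Finset.range m, vaW w x B ξ k * duDU w x B ξ m k =
      vaJ w x B m *
        (-(∑ i ∈ Finset.range m, (pcPx (ahPhase w x B i) (igDelta w (B i)) * (vaJ w x B i * vaN w x B ξ i) +
            pcPd (ahPhase w x B i) (igDelta w (B i)) * (π * vaJ w x B i) * ξ (B i)) / vaP w x B i) *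
          vaN w x B ξ m +
        (∑ k ∈ Finset.range m, vaW w x B ξ k * (deriv ξ (B k) * vaU w x B k) +
          ∑ i ∈ Finset.range m, ξ (B i) * (2 * π * Real.sin (2 * π * ahPhase w x B i)) *
            (vaJ w x B i * vaN w x B ξ i))) := by
  have h1 : ∑ k ∈ Finset.range m, vaW w x B ξ k * duDU w x B ξ m k =
      (∑ k ∈ Finset.range m, vaW w x B ξ k * vaDJ w x B k m) * vaN w x B ξ m +
        vaJ w x B m * ∑ k ∈ Finset.range m, vaW w x B ξ k * vaDN w x B ξ k m := by
    unfold duDU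
    rw [Finset.sum_mul, Finset.mul_sum, ← Finset.sum_add_distrib]
    exact Finset.sum_congr rfl fun k _ => by ring
  have hJ := (vaJ_pos w x B m).ne'
  have h2 : ∑ k ∈ Finset.range m, vaW w x B ξ k * vaDJ w x B k m =
      vaJ w x B m * ∑ k ∈ Finset.range m, vaW w x B ξ k * (vaDJ w x B k m / vaJ w x B m) := by
    rw [Finset.mul_sum]
    exact Finset.sum_congr rfl fun k _ => by field_simp
  rw [h1, h2, sum_vaW_mul_vaDJ B hw0 hw ξ m, sum_vaW_mul_vaDN B hw0 hw ξ le_rfl]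
  ring

/-- **`V Ψ_ε`, the first variation of the regularised functional** (`m` coordinates, `n = m`):
`∑_{k<m} a_kξ(B_k) ∂_kΨ_ε = g(X_m) e^T χ U/(U+ε) + G(X_m)·{e^T (VT) χ/(U+ε)
+ e^T χ'(N_{m₁}) (VN_{m₁})/(U+ε) - e^T χ (VU)/(U+ε)²}`, with `U = V X_m` (`sum_vaW_mul_vaDX`).
[folklore] -/
theorem sum_vaW_mul_duD (hw0 : 0 < w) (hw : π * w / 2 < 1) (ξ G g : ℝ → ℝ) (m m₁ : ℕ)
    (L ε : ℝ) :
    ∑ k ∈ Finset.range m, vaW w x B ξ k * duD w x h ξ G m m₁ L ε B g k =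
      g (ahPhase w x B m) * Real.exp (duT w x h B m) * duChi L (vaN w x B ξ m₁) *
          (duU w x B ξ m * (duU w x B ξ m + ε)⁻¹) +
        G (ahPhase w x B m) *
          (Real.exp (duT w x h B m) * (∑ k ∈ Finset.range m, vaW w x B ξ k * duDT w x h B m k) *
              duChi L (vaN w x B ξ m₁) * (duU w x B ξ m + ε)⁻¹ +
            Real.exp (duT w x h B m) * (duDChi L (vaN w x B ξ m₁) *
              ∑ k ∈ Finset.range m, vaW w x B ξ k * vaDN w x B ξ k m₁) * (duU w x B ξ m + ε)⁻¹ +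
            Real.exp (duT w x h B m) * duChi L (vaN w x B ξ m₁) *
              (-(∑ k ∈ Finset.range m, vaW w x B ξ k * duDU w x B ξ m k) / (duU w x B ξ m + ε) ^ 2)) := by
  have hU : ∑ k ∈ Finset.range m, vaW w x B ξ k * vaDX w x B k m = duU w x B ξ m := by
    rw [sum_vaW_mul_vaDX B hw0 hw ξ le_rfl]; rfl
  -- the summand is linear in the four section derivatives
  have key : ∀ k, vaW w x B ξ k * duD w x h ξ G m m₁ L ε B g k =
      (g (ahPhase w x B m) * Real.exp (duT w x h B m) * duChi L (vaN w x B ξ m₁) *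
          (duU w x B ξ m + ε)⁻¹) * (vaW w x B ξ k * vaDX w x B k m) +
        G (ahPhase w x B m) *
          ((Real.exp (duT w x h B m) * duChi L (vaN w x B ξ m₁) * (duU w x B ξ m + ε)⁻¹) *
              (vaW w x B ξ k * duDT w x h B m k) +
            (Real.exp (duT w x h B m) * duDChi L (vaN w x B ξ m₁) * (duU w x B ξ m + ε)⁻¹) *
              (vaW w x B ξ k * vaDN w x B ξ k m₁) +
            (Real.exp (duT w x h B m) * duChi L (vaN w x B ξ m₁) / (duU w x B ξ m + ε) ^ 2) *
              (-(vaW w x B ξ k * duDU w x B ξ m k))) := by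
    intro k; unfold duD; ring
  rw [Finset.sum_congr rfl fun k _ => key k]
  simp only [Finset.sum_add_distrib, ← Finset.mul_sum, Finset.sum_neg_distrib]
  rw [hU]
  ring

end Variation

end Literature.Barriers.AtomisticToContinuum.HeatConduction

end
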